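import Summits.CriticalPhenomena.PercolationContinuityZ3.Theorems.Transplant.SkelPhiEquilibriumDefs
import HarnessLib

/-!
# N1 params, part 0 (q-free arithmetic, consumer-independent): the TWO-SCALE LADDER of the {±1} node — the kit-route width `nS`, the long box `ML`,
# the long width `nL`, their floors, the scale list `SMn`, and the kit-route displacement inequality (D4) cleared of denominators — `Skelφ.NegPrm.*`

builds on p205010 (kernel theorem, internal audit signed; external expert review pending) — nothing in this file uses p205010.
Status sentence (coordinator 2026-08-20T04:30Z): "θ(p_c) = 0 on ℤ^d, all d ≥ 2 — kernel-verified (Lean 4/Mathlib, standard axioms); internal adversarial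
audit SIGNED 2026-08-20 04:29Z; external expert review pending."
Lane `prim-bschramm-*`, seat `prim-bschramm-stmt` (gen 11); helper file (`--supports stmt-CriticalPhenomena-4575 --as helper`); ledger HOME/prim-bschramm-stmt/NEG-PARAMS.md
§0 (n4)–(n6), (n5)(i)–(iii), 1H (v0.1).  N1 programme (NEG-SCOPE v1.1 §4.3, hp-8 C2/D4, P5-R1): the order of scales is `M_u → (M_s := M_u, n_s) → (h_s, ℓ_s, v_s) → M_L → n_L →
(h_L, ℓ_L, v_L)` — the long BOX `M_L` is chosen AFTER the short equilibrium data, every floor is put into `M_L` (so that `ℓ_L > M_L` inherits it; `ℓ_L` itself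
is an output of `EquilibriumAt`, not a choice), and nothing upstream reads the long data (no monotonicity of the equilibrium in the scale is used).  This file
is PURE ℕ-ARITHMETIC on the numbers handed by Step I″ (the threshold `n₁ M`, the zone scale `M_u`, the kit levels `R′`, the seed depth `ρz`, the short data
`|h_s|, ℓ_s, n_s`) and by the closure/instance (`K`, `C′`, `c_max`); it does not depend on the shape of `StepI.DataN` (ledger V0) nor on the cell-arithmetic
names of (C-1)/(C-2), so it can land at R0/R1.
* §1 `NegPrm.nS n₁Mu Mu R' ρz := max n₁Mu (Mu + R' + 2 + ρz)` + floors; `NegPrm.ML Mu C' cmax K R' hs ls ns := max (max Mu (2C'(hs+ls+ns))) (max (320·cmax − 1) (K(R'+2)))`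
  + the four floors; `NegPrm.nL n₁ML ML K R' := max n₁ML (max (ML+1) (K(R'+2)))` + floors; `NegPrm.topScale nL hL ℓL := pgScale nL hL (3ℓL)`;
* §2 `NegPrm.SMn Ms ns ML nL : Finset (ℕ × ℕ) := {(Ms, ns), (ML, nL)}` + membership;
* §3 **`NegPrm.hop_ineq`**: `2C'(hs+ls+ns) ≤ ML → ML ≤ lL → C'·((hs+ls)(ML+1) + ns·lL) ≤ lL·(ML+1)` — hp-8 D4's `|h_s| + ℓ_s + n_s·ℓ_L/(M_L+1) ≤ ℓ_L/C'`
  multiplied through by `C'(M_L+1)`.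
[cite: KozmaNitzan2024, §4 Theorem 6 (pp. 25–31): the order of constants] [cite: MartineauTassion2017, Lem. 3.5 (the scale `n ≥ n₁(B)` is free)]
-/

namespace Summit.CriticalPhenomena.PercolationContinuityZ3.Theorems.Transplant

namespace Skelφ

namespace NegPrm

/-! ## §1 The two-scale ladder -/

/-- **The kit-route (short) width** `n_s := max (n₁ M_u) (M_u + R′ + 2 + ρz)`: above Step I″'s threshold at the zone box `M_u` and above the kit/clamp
scale (pattern of D″'s unit floor `n₀ = M_u + R′ + 1 + …` and of `Sgn₂.n₀ := n₀ + ρz`). [this work] -/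
def nS (n₁Mu Mu R' ρz : ℕ) : ℕ := max n₁Mu (Mu + R' + 2 + ρz)

/-- `n₁ M_u ≤ n_s` (admissibility for `EquilibriumAt … M_u … n_s`). [folklore] -/
theorem n₁_le_nS (n₁Mu Mu R' ρz : ℕ) : n₁Mu ≤ nS n₁Mu Mu R' ρz := le_max_left _ _

/-- `M_u + R′ + 2 + ρz ≤ n_s`. [folklore] -/
theorem floor_le_nS (n₁Mu Mu R' ρz : ℕ) : Mu + R' + 2 + ρz ≤ nS n₁Mu Mu R' ρz := le_max_right _ _

/-- `M_u < n_s` (the `M < n` clause of `EquilibriumAt` at the short scale is not vacuous). [folklore] -/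
theorem Mu_lt_nS (n₁Mu Mu R' ρz : ℕ) : Mu < nS n₁Mu Mu R' ρz :=
  lt_of_lt_of_le (by omega) (floor_le_nS n₁Mu Mu R' ρz)

/-- `R′ ≤ n_s` and `ρz ≤ n_s` (the kit levels and the seed depth sit below the route scale). [folklore] -/
theorem R'_le_nS (n₁Mu Mu R' ρz : ℕ) : R' ≤ nS n₁Mu Mu R' ρz ∧ ρz ≤ nS n₁Mu Mu R' ρz :=
  ⟨le_trans (by omega) (floor_le_nS n₁Mu Mu R' ρz), le_trans (by omega) (floor_le_nS n₁Mu Mu R' ρz)⟩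

/-- **The long BOX** `M_L := max {M_u, 2C′(|h_s| + ℓ_s + n_s), 320·c_max − 1, K(R′ + 2)}` — chosen after the short data; floors: hp-8 D4 (kit-route displacement),
hp-8 §11 (ii) (y′-layer slack: `320·c ≤ M + 1`), the coarse reading of kit-level drift (`K(R′+2)`), and `M_u ≤ M_L` (the zone box is inside). [this work] -/
def ML (Mu C' cmax K R' hs ls ns : ℕ) : ℕ :=
  max (max Mu (2 * C' * (hs + ls + ns))) (max (320 * cmax - 1) (K * (R' + 2)))

/-- `M_u ≤ M_L`. [folklore] -/
theorem Mu_le_ML (Mu C' cmax K R' hs ls ns : ℕ) : Mu ≤ ML Mu C' cmax K R' hs ls ns :=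
  le_trans (le_max_left _ _) (le_max_left _ _)

/-- D4's floor: `2C′(|h_s| + ℓ_s + n_s) ≤ M_L`. [folklore] -/
theorem hop_floor_le_ML (Mu C' cmax K R' hs ls ns : ℕ) : 2 * C' * (hs + ls + ns) ≤ ML Mu C' cmax K R' hs ls ns :=
  le_trans (le_max_right _ _) (le_max_left _ _)

/-- hp-8 §11 (ii)'s floor: `320·c_max ≤ M_L + 1`. [folklore] -/
theorem slack_floor_le_ML (Mu C' cmax K R' hs ls ns : ℕ) : 320 * cmax ≤ ML Mu C' cmax K R' hs ls ns + 1 := by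
  have : 320 * cmax - 1 ≤ ML Mu C' cmax K R' hs ls ns := le_trans (le_max_left _ _) (le_max_right _ _)
  omega

/-- The coarse-reading floor: `K(R′ + 2) ≤ M_L` (hence `K ≤ M_L`). [folklore] -/
theorem coarse_floor_le_ML (Mu C' cmax K R' hs ls ns : ℕ) : K * (R' + 2) ≤ ML Mu C' cmax K R' hs ls ns ∧ K ≤ ML Mu C' cmax K R' hs ls ns := by
  have h : K * (R' + 2) ≤ ML Mu C' cmax K R' hs ls ns := le_trans (le_max_right _ _) (le_max_right _ _)
  exact ⟨h, le_trans (by nlinarith) h⟩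

/-- **The long (stride / cell) width** `n_L := max (n₁ M_L) (max (M_L + 1) (K(R′ + 2)))`. [this work] -/
def nL (n₁ML ML K R' : ℕ) : ℕ := max n₁ML (max (ML + 1) (K * (R' + 2)))

/-- `n₁ M_L ≤ n_L` (admissibility for `EquilibriumAt … M_L … n_L`). [folklore] -/
theorem n₁_le_nL (n₁ML ML K R' : ℕ) : n₁ML ≤ nL n₁ML ML K R' := le_max_left _ _

/-- `M_L < n_L`. [folklore] -/
theorem ML_lt_nL (n₁ML ML K R' : ℕ) : ML < nL n₁ML ML K R' :=
  lt_of_lt_of_le (Nat.lt_succ_self _) (le_trans (le_max_left _ _) (le_max_right _ _))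

/-- `K(R′ + 2) ≤ n_L`. [folklore] -/
theorem coarse_floor_le_nL (n₁ML ML K R' : ℕ) : K * (R' + 2) ≤ nL n₁ML ML K R' :=
  le_trans (le_max_right _ _) (le_max_right _ _)

/-- The long scale dominates the short one once `C′ ≥ 1`: `n_s < n_L` (via `2C′·n_s ≤ M_L < n_L`). [folklore] -/
theorem nS_lt_nL {Mu C' cmax K R' hs ls ns n₁ML : ℕ} (hC : 1 ≤ C') :
    ns < nL n₁ML (ML Mu C' cmax K R' hs ls ns) K R' := by
  have h1 := hop_floor_le_ML Mu C' cmax K R' hs ls ns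
  have h2 := ML_lt_nL n₁ML (ML Mu C' cmax K R' hs ls ns) K R'
  have h3 : ns ≤ 2 * C' * (hs + ls + ns) := by nlinarith
  omega

/-- **The planar top scale of the long parallelogram's link region** (`pgramPrism t n_L h_L (3ℓ_L) …`): `pgScale n_L h_L (3ℓ_L) = max n_L (3ℓ_L + |h_L|)` —
the `topScale` slot of the fibre schedule (NEG-PARAMS (n10)). [this work] -/
def topScale (nL : ℕ) (hL : ℤ) (ℓL : ℕ) : ℕ := pgScale nL hL (3 * ℓL)

/-- `n_L ≤ topScale`. [folklore] -/
theorem nL_le_topScale (nL : ℕ) (hL : ℤ) (ℓL : ℕ) : nL ≤ topScale nL hL ℓL := le_max_left _ _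

/-- `3ℓ_L + |h_L| ≤ topScale`. [folklore] -/
theorem height_le_topScale (nL : ℕ) (hL : ℤ) (ℓL : ℕ) : 3 * ℓL + hL.natAbs ≤ topScale nL hL ℓL := le_max_right _ _

/-! ## §2 The scale list -/

/-- **The list of (box, width) pairs at which Step I″'s piece-links are consumed**: the kit-route pair and the stride pair (NEG-PARAMS (n6); N4: one shape per
run family). [this work] -/
def SMn (Ms ns ML nL : ℕ) : Finset (ℕ × ℕ) := {(Ms, ns), (ML, nL)}

/-- The short pair is listed. [folklore] -/
theorem short_mem_SMn (Ms ns ML nL : ℕ) : (Ms, ns) ∈ SMn Ms ns ML nL := by simp [SMn]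

/-- The long pair is listed. [folklore] -/
theorem long_mem_SMn (Ms ns ML nL : ℕ) : (ML, nL) ∈ SMn Ms ns ML nL := by simp [SMn]

/-- Nothing else is listed. [folklore] -/
theorem mem_SMn_iff {Ms ns ML nL : ℕ} {x : ℕ × ℕ} : x ∈ SMn Ms ns ML nL ↔ x = (Ms, ns) ∨ x = (ML, nL) := by simp [SMn]

/-- The list has at most two members. [folklore] -/
theorem card_SMn_le (Ms ns ML nL : ℕ) : (SMn Ms ns ML nL).card ≤ 2 := Finset.card_le_two

/-! ## §3 The kit-route displacement inequality (hp-8 D4), cleared of denominators -/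

/-- **D4 in integers**: if `2C′(|h_s| + ℓ_s + n_s) ≤ M_L ≤ ℓ_L` then `C′·((|h_s| + ℓ_s)(M_L+1) + n_s·ℓ_L) ≤ ℓ_L·(M_L+1)`, i.e.
`|h_s| + ℓ_s + n_s·ℓ_L/(M_L+1) ≤ ℓ_L/C′` — a `P_s` kit route's displacement read in the long frame is at most a `1/C′` fraction of the long height. [this work] -/
theorem hop_ineq {C' hs ls ns M lL : ℕ} (hM : 2 * C' * (hs + ls + ns) ≤ M) (hℓ : M ≤ lL) :
    C' * ((hs + ls) * (M + 1) + ns * lL) ≤ lL * (M + 1) := by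
  have h1 : 2 * C' * (hs + ls) ≤ M := le_trans (by nlinarith) hM
  have h2 : 2 * C' * ns ≤ M := le_trans (by nlinarith) hM
  have h3 : 2 * C' * (hs + ls) * (M + 1) ≤ lL * (M + 1) :=
    Nat.mul_le_mul_right _ (le_trans h1 hℓ)
  have h4 : 2 * C' * ns * lL ≤ (M + 1) * lL :=
    Nat.mul_le_mul_right _ (le_trans h2 (Nat.le_succ _))
  have h5 : 2 * (C' * ((hs + ls) * (M + 1) + ns * lL)) ≤ 2 * (lL * (M + 1)) := by
    have e1 : 2 * (C' * ((hs + ls) * (M + 1) + ns * lL)) = 2 * C' * (hs + ls) * (M + 1) + 2 * C' * ns * lL := by ring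
    have e2 : 2 * (lL * (M + 1)) = lL * (M + 1) + (M + 1) * lL := by ring
    rw [e1, e2]
    exact Nat.add_le_add h3 h4
  exact Nat.le_of_mul_le_mul_left h5 (by norm_num)

/-- D4 at the ledger's values: with `M_L := ML …` and any `ℓ_L ≥ M_L` (from `EquilibriumAt`: `M_L < ℓ_L`). [this work] -/
theorem hop_ineq_ML {Mu C' cmax K R' hs ls ns lL : ℕ} (hℓ : ML Mu C' cmax K R' hs ls ns ≤ lL) :
    C' * ((hs + ls) * (ML Mu C' cmax K R' hs ls ns + 1) + ns * lL) ≤ lL * (ML Mu C' cmax K R' hs ls ns + 1) :=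
  hop_ineq (hop_floor_le_ML Mu C' cmax K R' hs ls ns) hℓ

end NegPrm

end Skelφ

end Summit.CriticalPhenomena.PercolationContinuityZ3.Theorems.Transplant
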